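import Literature.NumberTheory.EllipticCurves.GreenbergVatsal2000.CharacterPAdicLFunctions
import Literature.NumberTheory.EllipticCurves.HeegnerPoints
import HarnessLib
import HarnessLib.Audit.Tags

/-!
# Route `EisensteinPrimes`, crux 3 `MazurMCOnCellB` (stmt-BirchSwinnertonDyer-19033), line `twistback` v5 — the FIELD
# SUPPLY of sub-population (iii) of `stub_upperPartnerOffSubrow` as ONE typed predicate: «an admissible Heegner field
# whose twisted generalized Bernoulli number is a p-adic unit» (definition; width seat bsd-line-x2-p1-w5 g2;
# `--supports stmt-BirchSwinnertonDyer-19033`)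

WHY THIS FILE. The registered open stub 6′ `stub_upperPartnerOffSubrow` of `twistback` v5 (sha256 355e1eaf…) asks for ONE
admissible partner field per X2b pair off the closed sub-row. For its sub-population (iii) — non-split pairs at `p ≠ 3`
(class-wide content; no A10 cell) — the tree already holds the `K`-GIVEN doors at every odd `p` for arbitrary line
characters (LEAD bsd-line-x2-p1 g12, `Theorems/EisensteinPrimesMazurMCOnCellBTwistbackSubrowPartnerGivenBernoulli.lean`,
p659820: `upperPartner_at_of_{ramifiedOdd,unramifiedEven}_of_bernoulliUnit{,_of_thmE}`); what is missing is the SUPPLY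
of `K` (LEAD g12 verdict §2 (iii): «imaginary quadratic `K` in a residue class mod `p·M` with a Bernoulli unit»,
printed only at `p = 3` — Nakagawa–Horie–Taya, tree `…TwistbackSubrowPartner.exists_admissibleField_coprime_classNumber`).
Reading the doors' signatures, the supply they consume is, binder for binder, the predicate below. Stating it ONCE as an
importable `Prop` (i) lets a later skeleton register the supply as its own stub — a statement of analytic number
theory (class numbers / generalized Bernoulli numbers of imaginary quadratic twists with local conditions), separated
from the Iwasawa theory of the doors —, (ii) lets a typer match it against print (seeded: Kimura, Acta Arith. 110 (2003)
Thm. p. 39; Ito arXiv:1212.1392 Thm. 1.4; Byeon 2005 Prop. 1.2; seedless with `ℓ ∉ S`: Wiles 2015, Beckwith 2017 — the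
finer ramified condition at the primes dividing the character's conductor is in no printed STATEMENT; see the seat's
memo `FIELD-SUPPLY-LIT-w5g2.md`, evidence on the item), and (iii) lets kit certify it per datum (one field `K`).
The companion `Theorems/EisensteinPrimesMazurMCOnCellBTwistbackSubrowPartnerOfSupply.lean` feeds it into the doors.

HONEST FRAMING. ONE definition (a `Prop` with parameters, tagged `@[conjecture]` = open typed statement / obligation node:
for given data it may hold or fail; class-wide existence under the natural side conditions is what Cohen–Lenstra-type
heuristics predict and what no printed theorem supplies with the ramified refinement) + its `Iff.rfl` unfolding lemma;
no theorem about it, no named fact, no instance, no notation, no `sorry`. Nothing about class numbers, Bernoulli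
numbers, the Mazur main conjecture or BSD is asserted; 0 cells / labels / tiers move.

## The object

* `HeegnerFieldWithBernoulliUnit p N N₀ n n' χ` — there is an imaginary quadratic field `K` with: the Heegner
  hypothesis for `N`, for `p` (`p` SPLIT in `K`) and for `N₀`; `d_K` odd and `< −4`; `n`, `n'` prime to `d_K`; and
  `‖B_{1,θ}‖_p = 1` for `θ(a) = ω̃((χ(a)·(a/|d_K|))⁻¹)` of period `n·|d_K|` (`ω̃ = teichmullerLift p`, `(a/|d_K|)` the
  Jacobi symbol) — VERBATIM the field-dependent hypotheses `(hK, hHN, hHp, hoddK, hlt, hHN₀, hmK/hdK, hB)` of p659820's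
  doors, with `(n, χ, n') = (d, ψ, m)` in the FIRST X2b shape (line of `E` ramified-odd) and `(m, φ, d)` in the SECOND.
  For quadratic `χ` (automatic at `p = 3`) the unit condition reads `p ∤ 2h(ℚ(√(χ*·d_K)))/w` (w3 g7's
  `norm_twistedBernoulli_teichmullerLift_inv_eq_one_iff_of_isPrimitive`), and since the Euler factor at `p` is built in,
  it forces `(χ·χ_K)(p) ≠ 1`, i.e. `χ ≠ 1`: the auxiliary field always ramifies at the primes of `n`.

References: [GreenbergVatsal2000] §2 p. 28, §3 (26)–(28), Thm. (3.11); [Washington1997] Thm. 4.2, Thm. 5.11;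
[LangCyclotomic1990] Ch. 2 §2 (B 6–B 7); [NakagawaHorie1988] Thm. 1; [Gross1984] §1; [Darmon2004] Hypothesis 3.9;
I. Kimura, Acta Arith. 110 (2003) 37–43 (Thm. p. 39; Correction 114 (2004) 397); A. Ito, arXiv:1212.1392, Thm. 1.4;
A. Wiles, J. London Math. Soc. 92 (2015) 411–426; O. Beckwith, Res. Math. Sci. 4 (2017) (arXiv:1612.04443) Thm. 1.1;
tree: `…TwistbackSubrowPartnerGivenBernoulli.lean` (the doors), `…TwistbackSubrowPartner.lean` (the `p = 3` supply),
`GreenbergVatsal2000/CharacterPAdicLFunctions.lean` (`twistedBernoulli`, `teichmullerLift`), `HeegnerPoints.lean`.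
-/

set_option autoImplicit false

-- `Summit.BirchSwinnertonDyer.BirchSwinnertonDyer.…`: the summit and its single sub-problem share a name.
set_option linter.dupNamespace false

noncomputable section

open scoped Classical NumberTheorySymbols

open NumberField Literature.NumberTheory.EllipticCurves Literature.NumberTheory.EllipticCurves.GreenbergVatsal2000

namespace Summit.BirchSwinnertonDyer.BirchSwinnertonDyer.Theorems.EisensteinPrimesMazurMCOnCellBTwistbackFieldSupplyDefs

/-- **`HeegnerFieldWithBernoulliUnit p N N₀ n n' χ` — the field supply of twistback's sub-population (iii), typed.**
There is an imaginary quadratic field `K` such that: every prime dividing `N` splits in `K` (Heegner hypothesis for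
`N`), `p` splits in `K`, every prime dividing `N₀` splits in `K`; `d_K` is odd and `d_K < −4`; `n` and `n'` are prime to
`|d_K|`; and the generalized Bernoulli number `B_{1,θ}` of the `ℤ_p`-valued function
`θ(a) = ω̃((χ(a)·(a/|d_K|))⁻¹)` of period `n·|d_K|` (`ω̃` the Teichmüller lift extended by `0`, `(a/|d_K|)` the Jacobi
symbol, `χ` a `(ℤ/p)`-valued Dirichlet character mod `n`) is a `p`-adic UNIT. VERBATIM the `K`-dependent hypotheses of
the `K`-given doors `…TwistbackSubrowPartnerGivenBernoulli.upperPartner_at_of_{ramifiedOdd,unramifiedEven}_of_bernoulliUnit`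
(first shape: `(n, χ, n') = (d, ψ, m)`; second shape: `(m, φ, d)`). In print: at `p = 3` for quadratic `χ` with
`χ(3) = −1` (Nakagawa–Horie 1988 + Taya 2000, tree `exists_admissibleField_coprime_classNumber` gives the class-number
form); at `p ≥ 5` only SEEDED supply theorems without the ramified refinement at the primes of `n` (Kimura 2003,
Ito 2012) or seedless ones excluding conditions at `p` (Wiles 2015, Beckwith 2017). WHY IT MIGHT FAIL for given data:
`χ = 1` (trivial zero: `B_{1,θ} = 0` for every `K`), incompatible local data (e.g. `p ∣ n`, or `N`, `N₀` forcing a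
prime to be both split and ramified), or simply no admissible `K` with a unit — the predicate is a per-datum
statement, not a theorem. A `Prop` with parameters, tagged `@[conjecture]` (open typed statement, obligation node);
nothing asserted. [cite: GreenbergVatsal2000, §2 p. 28 and §3 (26)–(28)] [cite: LangCyclotomic1990, Ch. 2 §2 (B 6–B 7)]
[cite: NakagawaHorie1988, Thm. 1] [cite: Darmon2004, Hypothesis 3.9] -/
@[conjecture] def HeegnerFieldWithBernoulliUnit (p : ℕ) [Fact p.Prime] (N N₀ n n' : ℕ) [NeZero n]
    (χ : DirichletCharacter (ZMod p) n) : Prop :=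
  ∃ (K : Type) (_ : Field K) (_ : NumberField K), IsImaginaryQuadratic K ∧
    SatisfiesHeegnerHypothesis N K ∧ SatisfiesHeegnerHypothesis p K ∧ SatisfiesHeegnerHypothesis N₀ K ∧
    Odd (NumberField.discr K) ∧ NumberField.discr K < -4 ∧
    n.Coprime (NumberField.discr K).natAbs ∧ n'.Coprime (NumberField.discr K).natAbs ∧
    ‖twistedBernoulli p 1 (n * (NumberField.discr K).natAbs) (fun a : ℕ ↦ teichmullerLift p
        (χ (a : ZMod n) * ((J((a : ℤ) | (NumberField.discr K).natAbs) : ℤ) : ZMod p))⁻¹)‖ = 1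

/-- Unfolding lemma: `HeegnerFieldWithBernoulliUnit p N N₀ n n' χ` is by definition the displayed `∃`-statement (for
consumers that state the hypothesis in expanded form). [folklore] -/
theorem heegnerFieldWithBernoulliUnit_iff (p : ℕ) [Fact p.Prime] (N N₀ n n' : ℕ) [NeZero n]
    (χ : DirichletCharacter (ZMod p) n) :
    HeegnerFieldWithBernoulliUnit p N N₀ n n' χ ↔
      ∃ (K : Type) (_ : Field K) (_ : NumberField K), IsImaginaryQuadratic K ∧
        SatisfiesHeegnerHypothesis N K ∧ SatisfiesHeegnerHypothesis p K ∧ SatisfiesHeegnerHypothesis N₀ K ∧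
        Odd (NumberField.discr K) ∧ NumberField.discr K < -4 ∧
        n.Coprime (NumberField.discr K).natAbs ∧ n'.Coprime (NumberField.discr K).natAbs ∧
        ‖twistedBernoulli p 1 (n * (NumberField.discr K).natAbs) (fun a : ℕ ↦ teichmullerLift p
            (χ (a : ZMod n) * ((J((a : ℤ) | (NumberField.discr K).natAbs) : ℤ) : ZMod p))⁻¹)‖ = 1 :=
  Iff.rfl

end Summit.BirchSwinnertonDyer.BirchSwinnertonDyer.Theorems.EisensteinPrimesMazurMCOnCellBTwistbackFieldSupplyDefs

end
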